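import Mathlib.GroupTheory.Perm.Cycle.Basic
import Mathlib.GroupTheory.OrderOfElement
import HarnessLib

/-!
# Induced (first-return) permutation on a subset of darts — generic brick (G1a) of the Euler /
# planarity plan for the oriented tight map (`phase2/LEAN-FACES-DESIGN.md` §5.3 (G1))

HONEST FRAMING. Part of the venture `Summits/Ventures/Crystal3D` (cell `pub-crystal3d`, phase 2;
seat typer-bulk-2), but PURELY COMBINATORIAL and generic (folklore): no geometry, no
configuration. The planarity plan realises the oriented tight map as a SUB-rotation-system of the
hull triangulation: its rotation at a vertex is the hull rotation with the non-tight darts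
skipped, i.e. the FIRST-RETURN map of the ambient rotation `σ` to the subset `S` of tight darts.
This file builds that operation for an arbitrary permutation `σ` of a finite type and an
arbitrary finset `S`:

* `retTime σ S x` — the least `n ≥ 1` with `(σ ^ n) x ∈ S` (it exists for `x ∈ S`: `σ` has finite
  order); `induce σ S : Equiv.Perm D` — `x ↦ (σ ^ retTime) x` on `S`, the identity off `S`;
* `induce_apply_mem` / `induce_apply_of_not_mem`, the minimality lemma `pow_not_mem_of_lt_retTime`,
  and the characterisation `induce_eq_of_first_return` (any "first return" witness IS the value);
* `sameCycle_of_induce` (the induced permutation moves inside `σ`-cycles) and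
  **`exists_induce_pow_eq_of_sameCycle`** (it visits EVERY point of `S` in the `σ`-cycle: the
  cycles of `induce σ S` on `S` are exactly the nonempty traces `S ∩ (σ-cycle)`);
* one-point surgery, the step of every deletion argument: for `S' ⊆ S` and `x ∈ S'`,
  `induce_subset_apply_of_mem` (if the `S`-successor of `x` lies in `S'` it is the
  `S'`-successor) and `induce_subset_apply_of_not_mem` (if it does not but ITS `S`-successor does,
  the `S'`-successor is that second point — one skip).

Nothing here mentions GAP(1.26); faces, Euler characteristics and the deletion lemma (G1) proper
are NOT here.
-/

namespace Summit.Ventures.Crystal3D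

namespace RotSys

open Equiv Equiv.Perm Finset

variable {D : Type*} [Fintype D] [DecidableEq D]

/-! ## The first-return time and the induced permutation -/

omit [DecidableEq D] in
/-- A point of `S` returns to `S` under some positive power of `σ` (`σ` has finite order). -/
theorem exists_pow_mem (σ : Perm D) {S : Finset D} {x : D} (hx : x ∈ S) :
    ∃ n : ℕ, 0 < n ∧ (σ ^ n) x ∈ S :=
  ⟨orderOf σ, orderOf_pos σ, by rw [pow_orderOf_eq_one]; exact hx⟩

omit [Fintype D] in
open scoped Classical in
/-- **The first-return time** of `x` to `S` under `σ`: the least `n ≥ 1` with `(σ ^ n) x ∈ S`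
(junk `0` if there is none, which does not happen for `x ∈ S`). -/
noncomputable def retTime (σ : Perm D) (S : Finset D) (x : D) : ℕ :=
  if h : ∃ n : ℕ, 0 < n ∧ (σ ^ n) x ∈ S then Nat.find h else 0

/-- For `x ∈ S`: the first-return time is positive and the return lands in `S`. -/
theorem retTime_spec (σ : Perm D) {S : Finset D} {x : D} (hx : x ∈ S) :
    0 < retTime σ S x ∧ (σ ^ retTime σ S x) x ∈ S := by
  classical
  have h := exists_pow_mem σ hx
  unfold retTime
  rw [dif_pos h]
  exact Nat.find_spec h

/-- Minimality: no earlier positive power lands in `S`. -/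
theorem pow_not_mem_of_lt_retTime (σ : Perm D) {S : Finset D} {x : D} (hx : x ∈ S) {m : ℕ}
    (hm0 : 0 < m) (hm : m < retTime σ S x) : (σ ^ m) x ∉ S := by
  classical
  have h := exists_pow_mem σ hx
  unfold retTime at hm
  rw [dif_pos h] at hm
  intro hmem
  exact Nat.find_min h hm ⟨hm0, hmem⟩

/-- The first-return time is at most any positive return time. -/
theorem retTime_le_of_mem (σ : Perm D) {S : Finset D} {x : D} (hx : x ∈ S) {m : ℕ} (hm0 : 0 < m)
    (hmem : (σ ^ m) x ∈ S) : retTime σ S x ≤ m := by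
  by_contra hlt
  exact pow_not_mem_of_lt_retTime σ hx hm0 (not_le.1 hlt) hmem

omit [Fintype D] in
/-- The underlying function of the induced permutation. -/
noncomputable def induceFun (σ : Perm D) (S : Finset D) (x : D) : D :=
  if x ∈ S then (σ ^ retTime σ S x) x else x

omit [Fintype D] in
/-- On `S` the induced function is the first return. -/
theorem induceFun_of_mem (σ : Perm D) {S : Finset D} {x : D} (hx : x ∈ S) :
    induceFun σ S x = (σ ^ retTime σ S x) x := by
  unfold induceFun; rw [if_pos hx]

omit [Fintype D] in
/-- Off `S` the induced function is the identity. -/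
theorem induceFun_of_not_mem (σ : Perm D) {S : Finset D} {x : D} (hx : x ∉ S) :
    induceFun σ S x = x := by
  unfold induceFun; rw [if_neg hx]

/-- The induced function maps `S` into `S`. -/
theorem induceFun_mem (σ : Perm D) {S : Finset D} {x : D} (hx : x ∈ S) : induceFun σ S x ∈ S := by
  rw [induceFun_of_mem σ hx]
  exact (retTime_spec σ hx).2

/-- **The induced function is injective** (two first returns that agree come from the same
point, by minimality). -/
theorem induceFun_injective (σ : Perm D) (S : Finset D) : Function.Injective (induceFun σ S) := by
  intro x y h
  by_cases hx : x ∈ S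
  · by_cases hy : y ∈ S
    · rw [induceFun_of_mem σ hx, induceFun_of_mem σ hy] at h
      obtain ⟨hrx, -⟩ := retTime_spec σ hx
      obtain ⟨hry, -⟩ := retTime_spec σ hy
      set m := retTime σ S x with hm
      set n := retTime σ S y with hn
      -- WLOG compare `m` and `n`
      rcases lt_trichotomy m n with hlt | heq | hgt
      · -- `(σ^m) x = (σ^n) y` ⇒ `x = (σ^(n-m)) y ∈ S` with `0 < n - m < n`: contradiction
        exfalso
        have e : (σ ^ (n - m)) y = x := by
          have h2 : (σ ^ m) ((σ ^ (n - m)) y) = (σ ^ m) x := by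
            rw [← Perm.mul_apply, ← pow_add, Nat.add_sub_cancel' hlt.le, ← h]
          exact (σ ^ m).injective h2
        exact pow_not_mem_of_lt_retTime σ hy (Nat.sub_pos_of_lt hlt) (Nat.sub_lt hry hrx)
          (e ▸ hx)
      · rw [heq] at h
        exact (σ ^ n).injective h
      · exfalso
        have e : (σ ^ (m - n)) x = y := by
          have h2 : (σ ^ n) ((σ ^ (m - n)) x) = (σ ^ n) y := by
            rw [← Perm.mul_apply, ← pow_add, Nat.add_sub_cancel' hgt.le, h]
          exact (σ ^ n).injective h2
        exact pow_not_mem_of_lt_retTime σ hx (Nat.sub_pos_of_lt hgt) (Nat.sub_lt hrx hry)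
          (e ▸ hy)
    · -- `x ∈ S`, `y ∉ S`: images lie in `S` resp. equal `y ∉ S`
      exfalso
      rw [induceFun_of_not_mem σ hy] at h
      exact hy (h ▸ induceFun_mem σ hx)
  · by_cases hy : y ∈ S
    · exfalso
      rw [induceFun_of_not_mem σ hx] at h
      exact hx (h.symm ▸ induceFun_mem σ hy)
    · rwa [induceFun_of_not_mem σ hx, induceFun_of_not_mem σ hy] at h

/-- **The induced (first-return) permutation** of `σ` on `S`: first return to `S` on `S`,
identity off `S`. -/
noncomputable def induce (σ : Perm D) (S : Finset D) : Perm D :=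
  Equiv.ofBijective (induceFun σ S) (Finite.injective_iff_bijective.1 (induceFun_injective σ S))

/-- Unfolding `induce`. -/
theorem induce_apply (σ : Perm D) (S : Finset D) (x : D) : induce σ S x = induceFun σ S x := rfl

/-- On `S`: `induce σ S x = (σ ^ retTime σ S x) x`. -/
theorem induce_apply_of_mem (σ : Perm D) {S : Finset D} {x : D} (hx : x ∈ S) :
    induce σ S x = (σ ^ retTime σ S x) x := by
  rw [induce_apply, induceFun_of_mem σ hx]

/-- Off `S`: `induce σ S x = x`. -/
theorem induce_apply_of_not_mem (σ : Perm D) {S : Finset D} {x : D} (hx : x ∉ S) :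
    induce σ S x = x := by
  rw [induce_apply, induceFun_of_not_mem σ hx]

/-- `induce σ S` maps `S` to `S`. -/
theorem induce_apply_mem (σ : Perm D) {S : Finset D} {x : D} (hx : x ∈ S) : induce σ S x ∈ S := by
  rw [induce_apply]; exact induceFun_mem σ hx

/-- Membership in `S` is invariant under `induce σ S`. -/
theorem induce_apply_mem_iff (σ : Perm D) (S : Finset D) (x : D) : induce σ S x ∈ S ↔ x ∈ S := by
  constructor
  · intro h
    by_contra hx
    rw [induce_apply_of_not_mem σ hx] at h
    exact hx h
  · exact induce_apply_mem σ

/-- Powers of `induce σ S` keep `S`. -/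
theorem induce_pow_apply_mem (σ : Perm D) {S : Finset D} {x : D} (hx : x ∈ S) (k : ℕ) :
    (induce σ S ^ k) x ∈ S := by
  induction k with
  | zero => simpa using hx
  | succ k ih => rw [pow_succ', Perm.mul_apply]; exact induce_apply_mem σ ih

/-- **Characterisation by a first-return witness**: if `(σ ^ n) x = y ∈ S` with `n ≥ 1` and no
earlier positive power of `x` lies in `S`, then `induce σ S x = y`. -/
theorem induce_eq_of_first_return (σ : Perm D) {S : Finset D} {x y : D} (hx : x ∈ S) {n : ℕ}
    (hn0 : 0 < n) (hy : (σ ^ n) x = y) (hyS : y ∈ S)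
    (hmin : ∀ m, 0 < m → m < n → (σ ^ m) x ∉ S) : induce σ S x = y := by
  rw [induce_apply_of_mem σ hx]
  have h1 : retTime σ S x ≤ n := retTime_le_of_mem σ hx hn0 (hy ▸ hyS)
  have h2 : n ≤ retTime σ S x := by
    by_contra hlt
    exact hmin _ (retTime_spec σ hx).1 (not_le.1 hlt) (retTime_spec σ hx).2
  rw [le_antisymm h1 h2, hy]

/-! ## Cycles of the induced permutation = traces of the cycles of `σ` on `S` -/

/-- The induced permutation moves inside `σ`-cycles. -/
theorem sameCycle_induce_apply (σ : Perm D) (S : Finset D) (x : D) : σ.SameCycle x (induce σ S x) := by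
  by_cases hx : x ∈ S
  · rw [induce_apply_of_mem σ hx]
    exact ⟨(retTime σ S x : ℕ), by rw [zpow_natCast]⟩
  · rw [induce_apply_of_not_mem σ hx]

/-- Powers of the induced permutation move inside `σ`-cycles. -/
theorem sameCycle_induce_pow_apply (σ : Perm D) (S : Finset D) (x : D) (k : ℕ) :
    σ.SameCycle x ((induce σ S ^ k) x) := by
  induction k with
  | zero => simp only [pow_zero, Perm.one_apply]; exact Equiv.Perm.SameCycle.refl σ x
  | succ k ih =>
    rw [pow_succ', Perm.mul_apply]
    exact ih.trans (sameCycle_induce_apply σ S _)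

/-- Same cycle for the induced permutation implies same cycle for `σ`. -/
theorem sameCycle_of_induce (σ : Perm D) {S : Finset D} {x y : D}
    (h : (induce σ S).SameCycle x y) : σ.SameCycle x y := by
  obtain ⟨k, hk⟩ := h.exists_nat_pow_eq
  rw [← hk]
  exact sameCycle_induce_pow_apply σ S x k

/-- **The induced permutation visits every point of `S` on the `σ`-cycle**: for `x ∈ S` and
`y = (σ ^ n) x ∈ S`, some power of `induce σ S` takes `x` to `y`. -/
theorem exists_induce_pow_eq_of_pow_eq (σ : Perm D) {S : Finset D} {x : D} (hx : x ∈ S) :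
    ∀ n : ℕ, ∀ y : D, (σ ^ n) x = y → y ∈ S → ∃ k : ℕ, (induce σ S ^ k) x = y := by
  intro n
  induction n using Nat.strong_induction_on generalizing x with
  | _ n ih =>
    intro y hy hyS
    by_cases hn : n = 0
    · subst hn
      exact ⟨0, by simpa using hy⟩
    · -- the first return time `r ≤ n`; peel it off
      set r := retTime σ S x with hr
      obtain ⟨hr0, hrS⟩ := retTime_spec σ hx
      have hrn : r ≤ n := retTime_le_of_mem σ hx (Nat.pos_of_ne_zero hn) (hy ▸ hyS)
      have hy' : (σ ^ (n - r)) ((σ ^ r) x) = y := by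
        rw [← Perm.mul_apply, ← pow_add, Nat.sub_add_cancel hrn, hy]
      obtain ⟨k, hk⟩ := ih (n - r) (Nat.sub_lt (Nat.pos_of_ne_zero hn) hr0) hrS y hy' hyS
      refine ⟨k + 1, ?_⟩
      rw [pow_succ, Perm.mul_apply, induce_apply_of_mem σ hx]
      exact hk

/-- **Cycles of `induce σ S` on `S` are the traces of the `σ`-cycles**: for `x, y ∈ S`,
`(induce σ S).SameCycle x y ↔ σ.SameCycle x y`. -/
theorem sameCycle_induce_iff (σ : Perm D) {S : Finset D} {x y : D} (hx : x ∈ S) (hy : y ∈ S) :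
    (induce σ S).SameCycle x y ↔ σ.SameCycle x y := by
  refine ⟨sameCycle_of_induce σ, fun h => ?_⟩
  obtain ⟨n, hn⟩ := h.exists_nat_pow_eq
  obtain ⟨k, hk⟩ := exists_induce_pow_eq_of_pow_eq σ hx n y hn hy
  exact ⟨k, by rw [zpow_natCast, hk]⟩

/-- A point of `S` is FIXED by the induced permutation iff it is the only point of `S` on its
`σ`-cycle. -/
theorem induce_apply_eq_self_iff (σ : Perm D) {S : Finset D} {x : D} (hx : x ∈ S) :
    induce σ S x = x ↔ ∀ y ∈ S, σ.SameCycle x y → y = x := by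
  constructor
  · intro hfix y hy hxy
    obtain ⟨n, hn⟩ := hxy.exists_nat_pow_eq
    obtain ⟨k, hk⟩ := exists_induce_pow_eq_of_pow_eq σ hx n y hn hy
    -- a fixed point stays fixed under powers
    have hpow : ∀ j : ℕ, (induce σ S ^ j) x = x := by
      intro j
      induction j with
      | zero => simp
      | succ j ih => rw [pow_succ, Perm.mul_apply, hfix]; exact ih
    rw [← hk]
    exact hpow k
  · intro h
    exact h _ (induce_apply_mem σ hx) (sameCycle_induce_apply σ S x)

/-! ## One-point surgery: the induced permutation of a sub-subset -/

/-- Powers below the first-return time to the SMALLER set avoid it; phrased for a subset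
`S' ⊆ S`: an `S`-return that misses `S'` is not an `S'`-return. -/
theorem induce_subset_apply_of_mem (σ : Perm D) {S S' : Finset D} (hsub : S' ⊆ S) {x : D}
    (hx : x ∈ S') (hmem : induce σ S x ∈ S') : induce σ S' x = induce σ S x := by
  have hxS : x ∈ S := hsub hx
  obtain ⟨hr0, -⟩ := retTime_spec σ hxS
  refine induce_eq_of_first_return σ hx hr0 (induce_apply_of_mem σ hxS).symm hmem ?_
  intro m hm0 hm hmem'
  exact pow_not_mem_of_lt_retTime σ hxS hm0 hm (hsub hmem')

/-- **One skip**: for `S' ⊆ S` and `x ∈ S'`, if the `S`-successor `y = induce σ S x` is NOT in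
`S'` but its own `S`-successor `induce σ S y` is, then `induce σ S' x = induce σ S y`. -/
theorem induce_subset_apply_of_not_mem (σ : Perm D) {S S' : Finset D} (hsub : S' ⊆ S) {x : D}
    (hx : x ∈ S') (hnot : induce σ S x ∉ S') (hmem : induce σ S (induce σ S x) ∈ S') :
    induce σ S' x = induce σ S (induce σ S x) := by
  have hxS : x ∈ S := hsub hx
  set y := induce σ S x with hy
  have hyS : y ∈ S := induce_apply_mem σ hxS
  obtain ⟨hr0, -⟩ := retTime_spec σ hxS
  obtain ⟨hs0, -⟩ := retTime_spec σ hyS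
  set r := retTime σ S x with hr
  set s := retTime σ S y with hs
  have hval : (σ ^ (r + s)) x = induce σ S y := by
    rw [add_comm, pow_add, Perm.mul_apply, ← induce_apply_of_mem σ hxS, ← hy,
      ← induce_apply_of_mem σ hyS]
  refine induce_eq_of_first_return σ hx (by omega) hval hmem ?_
  intro m hm0 hm hmem'
  rcases lt_trichotomy m r with hlt | heq | hgt
  · exact pow_not_mem_of_lt_retTime σ hxS hm0 hlt (hsub hmem')
  · rw [heq, ← induce_apply_of_mem σ hxS] at hmem'
    exact hnot hmem'
  · -- `r < m < r + s`: `(σ^m) x = (σ^(m-r)) y` with `0 < m - r < s`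
    have e : (σ ^ m) x = (σ ^ (m - r)) y := by
      rw [hy, induce_apply_of_mem σ hxS, ← hr, ← Perm.mul_apply, ← pow_add,
        Nat.sub_add_cancel hgt.le]
    rw [e] at hmem'
    exact pow_not_mem_of_lt_retTime σ hyS (Nat.sub_pos_of_lt hgt) (by omega) (hsub hmem')

/-- In particular for ERASING ONE point `d`: for `x ∈ S`, `x ≠ d`, the `(S.erase d)`-successor
of `x` is the `S`-successor if that is `≠ d`, and the `S`-successor of `d` otherwise (provided
`induce σ S d ≠ d`, i.e. `d` is not alone on its `σ`-cycle in `S`). -/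
theorem induce_erase_apply (σ : Perm D) {S : Finset D} {d x : D} (hx : x ∈ S) (hxd : x ≠ d)
    (hdd : induce σ S d ≠ d) :
    induce σ (S.erase d) x =
      if induce σ S x = d then induce σ S d else induce σ S x := by
  have hx' : x ∈ S.erase d := Finset.mem_erase.2 ⟨hxd, hx⟩
  split_ifs with h
  · have hnot : induce σ S x ∉ S.erase d := by rw [h]; exact Finset.notMem_erase d S
    have hdS : d ∈ S := h ▸ induce_apply_mem σ hx
    have hmem : induce σ S (induce σ S x) ∈ S.erase d := by
      rw [h]
      exact Finset.mem_erase.2 ⟨hdd, induce_apply_mem σ hdS⟩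
    rw [induce_subset_apply_of_not_mem σ (Finset.erase_subset d S) hx' hnot hmem, h]
  · exact induce_subset_apply_of_mem σ (Finset.erase_subset d S) hx'
      (Finset.mem_erase.2 ⟨h, induce_apply_mem σ hx⟩)

end RotSys

end Summit.Ventures.Crystal3D
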